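import Summits.QuantumFields.YangMills.Theses.SpecificationCompactness
import Literature.MathematicalPhysics.QuantumFieldTheory.Balaban1983to89.T3HeightwiseDensityBounds
import Summits.QuantumFields.YangMills.Theorems.SpecificationCompactnessUIOfHeightZeroBound
import HarnessLib

/-!
# Route `SpecificationCompactness`, crux `UnitDensityUI` (C2, stmt-QuantumFields-28251), LINE «heightwise_stability»:
# the REGISTERED STUB `stub_uiOfHeightZeroBound` BY NAME AND SIGNATURE

This file reproduces VERBATIM the abbreviations and stub statements of the registered skeleton v2
`pub/ideators/ym-idea-5/lineK13-specification_compactness/bc/UnitDensityUI_heightwise.lean` (planner ym-idea-5 g9, `ledger skeleton check`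
15:14Z: `G2`, `X0`, `pi0`, `nud`, `UIBody`, `HeightZeroBody`, `HeightZeroUpperBound`, `UIOfHeightZeroBound`, `__Registered.*`, the one-reader
lemma `heightZero_of_heightwise` and the composition `UnitDensityUI_of`) and proves the registered STUB 2
`theorem stub_uiOfHeightZeroBound : __Registered.stub_uiOfHeightZeroBound` from the landed content
`Theorems.SpecificationCompactnessUIOfHeightZeroBound.uiOfHeightZeroBound` (height-`0` density = `ρ̂_K`, `∫ρ̂_K dπ₀ = Z_K`, a uniformly
bounded family is uniformly integrable).  Whoever proves STUB 1 imports this file and states `theorem stub_heightZeroUpperBound`.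

Free-hands work of seat `ym-line-fcl-p3` g14 (cell ym-idea-1) for planner ym-idea-5.  HONEST FRAMING: STUB 1 `stub_heightZeroUpperBound`
(L, load-bearing: Bałaban's (5)-upper/(6) at height 0, one reader with crux 26905 / `HeightwiseUpperBound`) is NOT proved here, so the
composition `UnitDensityUI_of` stays conditional on it; no crux, route, rung, continuum limit or mass gap is proved.
References: T. Bałaban, CMP 102 (1985) 255 [cite: Balaban1985UV3, (2) p.256, (5)-(6) p.257].
-/

set_option autoImplicit false

noncomputable section

namespace Summit.QuantumFields.YangMills.Cruxes.UnitDensityUI.HeightwiseStability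

open scoped BigOperators Topology Classical MeasureTheory ProbabilityTheory NNReal ENNReal
open Filter Set Function MeasureTheory
open Literature.MathematicalPhysics.QuantumFieldTheory
open Literature.MathematicalPhysics.QuantumFieldTheory.Balaban1983to89
open Literature.MathematicalPhysics.QuantumFieldTheory.Balaban1983to89.T3UnitLawDensityEML
open Literature.MathematicalPhysics.QuantumFieldTheory.Balaban1983to89.T3HeightwiseDensityBounds

/-- The gauge group `SU(2)` (verbatim from the skeleton). -/
abbrev G2 : Type := Matrix.specialUnitaryGroup (Fin 2) ℂ

variable (F : T3ContinuumYM3Torus.T3Family)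

/-- The fixed unit-lattice configuration space `X₀ = SU(2)^{unit bonds}` (verbatim from the skeleton). -/
abbrev X0 : Type := GaugeField (F.P 0) 0 G2

/-- Normalised product Haar measure `π₀` on `X₀` (verbatim from the skeleton). -/
noncomputable abbrev pi0 : Measure (X0 F) := fieldMeasure (F.P 0) 0 G2

/-- The normalised unit density `ρ̂_K / ∫ ρ̂_K dπ₀` (verbatim from the skeleton). -/
noncomputable abbrev nud (γ : ℝ) (K : ℕ) (V : X0 F) : ℝ :=
  (∫ W, unitDensity F γ K W ∂(pi0 F))⁻¹ * unitDensity F γ K V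

/-- The body of the crux `UnitDensityUI` at `(F, γ)` (verbatim from the skeleton). -/
def UIBody (γ : ℝ) : Prop :=
  ∀ ε : ℝ, 0 < ε → ∃ (M : ℝ) (K₀ : ℕ), ∀ K : ℕ, K₀ ≤ K → ∫ V, max (nud F γ K V - M) 0 ∂(pi0 F) ≤ ε

/-- The height-`0` clause of `HeightwiseUpperBound F γ`: `Z_K⁻¹ · heightDensity_{K,0} ≤ C` a.e., `C` independent of `K` (verbatim from
the skeleton). -/
def HeightZeroBody (γ : ℝ) : Prop :=
  ∃ C : ℝ, ∀ K : ℕ, ∀ᵐ V ∂(pi0 F),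
    (Missing.partitionFn (G := G2) (F.P K) ((F.scheme ℰp γ).β K))⁻¹ * T3TiltDescent.heightDensity F γ (Nat.zero_le K) Set.univ V ≤ C

/-! ## Stubs (verbatim from the skeleton) -/

/-- STUB 1 (L, load-bearing; one reader with `T3HeightwiseDensityBounds.HeightwiseUpperBound`). BAŁABAN'S (5)-UPPER + (6) AT HEIGHT 0
for the pinned densities, in a window of small unit couplings.  NOT proved in this file. -/
def HeightZeroUpperBound : Prop :=
  ∃ γ₁ : ℝ, 0 < γ₁ ∧ ∀ (F : T3ContinuumYM3Torus.T3Family) (γ : ℝ), 0 < γ → γ ≤ γ₁ → HeightZeroBody F γ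

/-- STUB 2 (M, provable). THE HEIGHT-0 DENSITY IS `ρ̂_K`, `∫ρ̂_K dπ₀ = Z_K`, AND A UNIFORMLY BOUNDED FAMILY IS UNIFORMLY INTEGRABLE. -/
def UIOfHeightZeroBound : Prop :=
  ∀ (F : T3ContinuumYM3Torus.T3Family) (γ : ℝ), 0 < γ → HeightZeroBody F γ → UIBody F γ

namespace __Registered
/-- registered stub alias (verbatim from the skeleton). -/ abbrev stub_heightZeroUpperBound : Prop := HeightZeroUpperBound
/-- registered stub alias (verbatim from the skeleton). -/ abbrev stub_uiOfHeightZeroBound : Prop := UIOfHeightZeroBound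
end __Registered

/-! ## The registered STUB 2, by name and signature -/

/-- **STUB 2 `stub_uiOfHeightZeroBound` HOLDS**: the height-`0` density on `univ` is `ρ̂_K`, `∫ρ̂_K dπ₀ = Z_K`, so the a.e. bound
`Z_K⁻¹ρ̂_K ≤ C` makes `(ρ̂_K/∫ρ̂_K − C)₊ = 0` a.e. and the UI body holds with `M := C`, `K₀ := 0`. [cite: Balaban1985UV3, (2) p.256, (5)-(6) p.257] -/
theorem stub_uiOfHeightZeroBound : __Registered.stub_uiOfHeightZeroBound :=
  fun F γ hγ h => Summit.QuantumFields.YangMills.Theorems.SpecificationCompactnessUIOfHeightZeroBound.uiOfHeightZeroBound F γ hγ h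

/-! ## One reader (verbatim from the skeleton): the tree schema `HeightwiseUpperBound` gives STUB 1's body at `(F, γ)` — its `n = 0` clause -/

/-- `HeightwiseUpperBound F γ` ⇒ the height-`0` body (its `n = 0` clause). [cite: Balaban1985UV3, (5)-(6) p.257] -/
theorem heightZero_of_heightwise (γ : ℝ) (h : HeightwiseUpperBound F γ) : HeightZeroBody F γ := by
  obtain ⟨C, hC⟩ := h 0
  exact ⟨C, fun K => hC K (Nat.zero_le K)⟩

/-! ## Composition (verbatim from the skeleton) -/

/-- The two stubs imply the crux `UnitDensityUI` BY NAME (STUB 1 remains a hypothesis). [cite: Balaban1985UV3, (5)-(6) p.257] -/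
theorem UnitDensityUI_of (hA : __Registered.stub_heightZeroUpperBound) (hB : __Registered.stub_uiOfHeightZeroBound) :
    Summit.QuantumFields.YangMills.Theses.SpecificationCompactness.UnitDensityUI := by
  obtain ⟨γ₁, hγ₁, h1⟩ := hA
  refine ⟨γ₁, hγ₁, fun F γ hγ hle => ?_⟩
  exact hB F γ hγ (h1 F γ hγ hle)

/-- **THE CRUX MODULO STUB 1 ONLY**: `UnitDensityUI ⇐ stub_heightZeroUpperBound` (STUB 2 discharged). [cite: Balaban1985UV3, (5)-(6) p.257] -/
theorem unitDensityUI_of_heightZeroUpperBound (hA : __Registered.stub_heightZeroUpperBound) :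
    Summit.QuantumFields.YangMills.Theses.SpecificationCompactness.UnitDensityUI :=
  UnitDensityUI_of hA stub_uiOfHeightZeroBound

/-- **THE CRUX FROM THE TREE SCHEMA IN A WINDOW**: if `HeightwiseUpperBound F γ` holds for all families and all `0 < γ ≤ γ₁`, then
`UnitDensityUI`. [cite: Balaban1985UV3, (5)-(6) p.257] -/
theorem unitDensityUI_of_heightwiseUpperBound {γ₁ : ℝ} (hγ₁ : 0 < γ₁)
    (h : ∀ (F : T3ContinuumYM3Torus.T3Family) (γ : ℝ), 0 < γ → γ ≤ γ₁ → HeightwiseUpperBound F γ) :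
    Summit.QuantumFields.YangMills.Theses.SpecificationCompactness.UnitDensityUI :=
  unitDensityUI_of_heightZeroUpperBound ⟨γ₁, hγ₁, fun F γ hγ hle => heightZero_of_heightwise F γ (h F γ hγ hle)⟩

end Summit.QuantumFields.YangMills.Cruxes.UnitDensityUI.HeightwiseStability

end
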